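import Mathlib.RingTheory.Kaehler.Basic
import Mathlib.RingTheory.Derivation.Basic
import Mathlib.RingTheory.AlgebraicIndependent.TranscendenceBasis
import Mathlib.FieldTheory.Separable
import Mathlib.FieldTheory.Perfect
import Mathlib.FieldTheory.Minpoly.Field
import Mathlib.LinearAlgebra.Dimension.Constructions
import Mathlib.RingTheory.Finiteness.Basic
import Mathlib.Algebra.Polynomial.Lifts
import Mathlib.Algebra.Algebra.Rat
import HarnessLib

/-!
# Rosenlicht's exposition of Ax's differential algebra, II: differentials of algebraic
# elements, `dim ≤ trdeg`, and Rosenlicht's Prop. 4 (named fact)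

Trunk T-TRANSCEND (`Literature/NumberTheory/Transcendental`). Second support file for discharging
the named fact `Literature.NumberTheory.Transcendental.ax_schanuel` (`AxSchanuel.lean`, Ax 1971 Thm. 3), following

* M. Rosenlicht, *On Liouville's theory of elementary functions*, Pacific J. Math. 65 (1976),
  485–492, §1 ("a succinct and somewhat simplified treatment of the necessary parts of Ax's
  paper"), Props. 3 and 4 (pp. 486–487).

With `Ω[K⁄k]` Mathlib's Kähler differentials and `d = KaehlerDifferential.D k K`:

* **Prop. 3, first half** ("each element of `K` satisfies a separable polynomial equation with
  coefficients in `k[{x_α}]`, and by applying `d` to these equations we see that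
  `dK ⊆ Σ K dx_α`"), PROVED in the quantitative form used by Ax's theorem: over fields of
  characteristic zero a `k`-derivation kills every element algebraic over `k`
  (`derivation_eq_zero_of_isAlgebraic`); more generally an element algebraic over `k[t₁,…,t_r]` has
  its differential in the `K`-span of `dt₁, …, dt_r` (`derivation_mem_of_eval_eq_zero`,
  `derivation_apply_mem_span_of_mem_adjoin`), whence
  `dim_K span_K d(S) ≤ trdeg_k k[S]` for finite `S ⊆ K` (`finrank_span_le_trdeg_adjoin`).
* **Prop. 4** ("`Σ cᵢ duᵢ/uᵢ + dv = 0` in `Ω_{K/k}` iff each `uᵢ` and `v` is algebraic over `k`",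
  for `cᵢ ∈ k` linearly independent over `ℚ`), vendored as the NAMED FACT `Rosenlicht1976_prop4`;
  its elementary direction (⇐) is PROVED (`Rosenlicht1976_prop4_mpr`). The deep direction (⇒)
  (Rosenlicht: reduction to `K` normal over `k(u₁)`, Galois averaging, partial fractions in
  `k(u₁)`) is the one transcendence input of Ax's theorem and is left as the named fact.

## References

* M. Rosenlicht, *On Liouville's theory of elementary functions*, Pacific J. Math. 65 (1976),
  no. 2, 485–492, doi:10.2140/pjm.1976.65.485: Props. 3, 4 (pp. 486–487).
* J. Ax, *On Schanuel's conjectures*, Ann. of Math. 93 (1971), 252–268, §§1–3.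
-/

noncomputable section

open KaehlerDifferential Polynomial Cardinal

namespace Literature.NumberTheory.Transcendental.Rosenlicht

/-! ### The named fact: Rosenlicht 1976, Prop. 4 -/

/-- **Rosenlicht 1976, Prop. 4.** "Let `k ⊆ K` be fields of characteristic zero, let
`u₁, …, uₙ, v` be elements of `K`, with `u₁, …, uₙ` nonzero, and let `c₁, …, cₙ` be elements
of `k` that are linearly independent over the rational numbers `ℚ`. Then the element
`c₁ du₁/u₁ + ⋯ + cₙ duₙ/uₙ + dv` of `Ω_{K/k}` is zero if and only if each `u₁, …, uₙ, v` is
algebraic over `k`." Here `Ω_{K/k} = Ω[K⁄k]` (Mathlib's Kähler differentials, Rosenlicht's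
Prop. 1), `d = KaehlerDifferential.D k K`, `duᵢ/uᵢ = uᵢ⁻¹ • duᵢ`, and `k ⊆ K` is an arbitrary
field extension `[Algebra k K]` (`K` has characteristic zero along with `k`). The direction (⇐) is
proved below (`Rosenlicht1976_prop4_mpr`); (⇒) is the deep one.
[cite: Rosenlicht1976, Prop. 4] -/
def Rosenlicht1976_prop4 : Prop :=
  ∀ (k K : Type) [Field k] [CharZero k] [Field K] [Algebra k K] (n : ℕ) (c : Fin n → k)
    (u : Fin n → K) (v : K), LinearIndependent ℚ c → (∀ i, u i ≠ 0) →
      ((∑ i, algebraMap k K (c i) • (u i)⁻¹ • D k K (u i)) + D k K v = 0 ↔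
        (∀ i, IsAlgebraic k (u i)) ∧ IsAlgebraic k v)

/-! ### Prop. 3 (first half): derivations kill algebraic elements -/

section Algebraic

variable {k K M : Type*} [Field k] [CharZero k] [Field K] [Algebra k K]
  [AddCommGroup M] [Module K M] [Module k M]

/-- Over a field `k` of characteristic zero, every `k`-derivation of an extension field `K`
kills the elements of `K` algebraic over `k`: differentiate the (separable) minimal equation,
`0 = δ(p(x)) = p'(x) δx` with `p'(x) ≠ 0`. (Rosenlicht 1976, proof of Prop. 3: "each element
satisfies a separable polynomial equation … applying `d` to these equations".)
[cite: Rosenlicht1976, Prop. 3 (proof)] -/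
theorem derivation_eq_zero_of_isAlgebraic (δ : Derivation k K M) {x : K}
    (hx : IsAlgebraic k x) : δ x = 0 := by
  have hint : IsIntegral k x := hx.isIntegral
  have hsep : (minpoly k x).Separable := (minpoly.irreducible hint).separable
  have h1 : aeval x (derivative (minpoly k x)) ≠ 0 :=
    hsep.aeval_derivative_ne_zero (minpoly.aeval k x)
  have h2 := δ.map_aeval (minpoly k x) x
  rw [minpoly.aeval, map_zero] at h2
  exact (smul_eq_zero.mp h2.symm).resolve_left h1

/-- In particular `dx = 0` in `Ω[K⁄k]` for `x ∈ K` algebraic over `k` (Rosenlicht 1976, Prop. 3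
and the first sentence of the proof of Prop. 4: "the element `dv` of `Ω_{k(v)/k}` is zero if and
only if `v` is algebraic over `k`" — the "if" half). [cite: Rosenlicht1976, Prop. 3] -/
theorem D_eq_zero_of_isAlgebraic {x : K} (hx : IsAlgebraic k x) : D k K x = 0 :=
  derivation_eq_zero_of_isAlgebraic (D k K) hx

/-- **Rosenlicht 1976, Prop. 4, direction (⇐)** (proved): if `u₁, …, uₙ, v` are algebraic over
`k` then `Σ cᵢ duᵢ/uᵢ + dv = 0` in `Ω[K⁄k]` (each `duᵢ` and `dv` vanishes; no hypothesis on the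
`cᵢ` or on `uᵢ ≠ 0` is needed for this direction). [cite: Rosenlicht1976, Prop. 4] -/
theorem Rosenlicht1976_prop4_mpr {n : ℕ} (c : Fin n → k) (u : Fin n → K) (v : K)
    (hu : ∀ i, IsAlgebraic k (u i)) (hv : IsAlgebraic k v) :
    (∑ i, algebraMap k K (c i) • (u i)⁻¹ • D k K (u i)) + D k K v = 0 := by
  rw [D_eq_zero_of_isAlgebraic hv, add_zero]
  exact Finset.sum_eq_zero fun i _ => by rw [D_eq_zero_of_isAlgebraic (hu i), smul_zero, smul_zero]

end Algebraic

/-! ### Prop. 3 (first half), relative form: differentials of elements algebraic over `k[t]` -/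

section Relative

/-- Differentiating a polynomial identity coefficientwise: if every coefficient `aₑ` of
`p ∈ A[X]` has `δ aₑ ∈ N` for an `A`-submodule `N`, then
`δ(p(x)) ≡ p'(x) δx (mod N)` (`δ(Σ aₑ xᵉ) = Σ xᵉ δaₑ + (Σ e aₑ xᵉ⁻¹) δx`). [folklore] -/
theorem derivation_eval_sub_smul_mem {R A M : Type*} [CommRing R] [CommRing A] [Algebra R A]
    [AddCommGroup M] [Module A M] [Module R M] [IsScalarTower R A M] (δ : Derivation R A M)
    (N : Submodule A M) (p : A[X]) (hp : ∀ i, δ (p.coeff i) ∈ N) (x : A) :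
    δ (p.eval x) - (p.derivative.eval x) • δ x ∈ N := by
  have h1 : p.eval x = p.sum fun e a => a * x ^ e := eval_eq_sum
  have h2 : p.derivative.eval x = p.sum fun e a => a * e * x ^ (e - 1) := derivative_eval p x
  rw [h1, h2, Polynomial.sum_def, Polynomial.sum_def, map_sum, Finset.sum_smul,
    ← Finset.sum_sub_distrib]
  refine Submodule.sum_mem _ fun e _ => ?_
  rw [δ.leibniz, δ.leibniz_pow]
  have : p.coeff e • (e • x ^ (e - 1) • δ x) = (p.coeff e * e * x ^ (e - 1)) • δ x := by
    rw [mul_smul, mul_smul, Nat.cast_smul_eq_nsmul]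
  rw [this, add_sub_cancel_left]
  exact Submodule.smul_mem _ _ (hp e)

variable {k K M : Type*} [Field k] [Field K] [Algebra k K] [AddCommGroup M] [Module K M] [Module k M]

/-- The elements of `K` whose derivative lies in a given `K`-subspace `N ⊆ M` form a subfield of
`K` (Leibniz rule and `δ(a⁻¹) = -a⁻² δa`). [folklore] -/
def derivationPreimage (δ : Derivation k K M) (N : Submodule K M) : Subfield K where
  carrier := {a | δ a ∈ N}
  mul_mem' {a b} ha hb := by
    simp only [Set.mem_setOf_eq, δ.leibniz]
    exact N.add_mem (N.smul_mem a hb) (N.smul_mem b ha)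
  one_mem' := by simp only [Set.mem_setOf_eq, δ.map_one_eq_zero]; exact N.zero_mem
  add_mem' {a b} ha hb := by simp only [Set.mem_setOf_eq, map_add]; exact N.add_mem ha hb
  zero_mem' := by simp only [Set.mem_setOf_eq, map_zero]; exact N.zero_mem
  neg_mem' {a} ha := by simp only [Set.mem_setOf_eq, map_neg]; exact N.neg_mem ha
  inv_mem' a ha := by
    simp only [Set.mem_setOf_eq, δ.leibniz_inv]
    exact N.smul_mem _ ha

/-- Membership in `derivationPreimage δ N`: `δ a ∈ N`. [folklore] -/
@[simp] theorem mem_derivationPreimage {δ : Derivation k K M} {N : Submodule K M} {a : K} :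
    a ∈ derivationPreimage δ N ↔ δ a ∈ N :=
  Iff.rfl

/-- **Differentials of algebraic elements, relative form** (Rosenlicht 1976, proof of Prop. 3, in
characteristic zero): if `x ∈ K` is a root of a non-zero polynomial `p ∈ K[X]` all of whose
coefficients `a` satisfy `δ a ∈ N` (a `K`-subspace of the target of the `k`-derivation `δ`), then
`δ x ∈ N`. Proof: the coefficients lie in the subfield `F = {a | δa ∈ N}`, so `x` is algebraic
over `F` with separable minimal polynomial `q`; differentiating `q(x) = 0` coefficientwise gives
`q'(x) δx ∈ N` with `q'(x) ≠ 0`. [cite: Rosenlicht1976, Prop. 3 (proof)] -/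
theorem derivation_mem_of_eval_eq_zero [CharZero K] [IsScalarTower k K M] (δ : Derivation k K M)
    (N : Submodule K M) {p : K[X]} (hp0 : p ≠ 0) (hp : ∀ i, δ (p.coeff i) ∈ N) {x : K}
    (hx : p.eval x = 0) : δ x ∈ N := by
  classical
  set F : Subfield K := derivationPreimage δ N with hF
  -- `p` lifts to `F[X]`
  have hlift : p ∈ Polynomial.lifts (algebraMap F K) := by
    rw [lifts_iff_coeff_lifts]
    intro i
    exact ⟨⟨p.coeff i, hp i⟩, rfl⟩
  obtain ⟨q, hq⟩ := (mem_lifts _).mp hlift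
  have hq0 : q ≠ 0 := by
    rintro rfl
    rw [Polynomial.map_zero] at hq
    exact hp0 hq.symm
  have hqx : aeval x q = 0 := by rw [← eval_map_algebraMap, hq, hx]
  -- `x` is algebraic over `F`, with separable minimal polynomial
  haveI : CharZero F := (algebraMap F K).charZero
  have halg : IsAlgebraic F x := ⟨q, hq0, hqx⟩
  have hint : IsIntegral F x := halg.isIntegral
  have hsep : (minpoly F x).Separable := (minpoly.irreducible hint).separable
  have hne : aeval x (derivative (minpoly F x)) ≠ 0 :=
    hsep.aeval_derivative_ne_zero (minpoly.aeval F x)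
  -- differentiate the minimal equation coefficientwise
  have hrc : ∀ i, δ (((minpoly F x).map (algebraMap F K)).coeff i) ∈ N := fun i => by
    rw [coeff_map]
    exact ((minpoly F x).coeff i).2
  have h := derivation_eval_sub_smul_mem δ N ((minpoly F x).map (algebraMap F K)) hrc x
  rw [derivative_map, eval_map_algebraMap, eval_map_algebraMap, minpoly.aeval, map_zero, zero_sub,
    neg_mem_iff] at h
  have := N.smul_mem (aeval x (derivative (minpoly F x)))⁻¹ h
  rwa [smul_smul, inv_mul_cancel₀ hne, one_smul] at this

/-- The derivative of every element of `k[s]` lies in the `K`-span of `δ(s)`. [folklore] -/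
theorem derivation_apply_mem_span_of_mem_adjoin (δ : Derivation k K M) (s : Set K) {a : K}
    (ha : a ∈ Algebra.adjoin k s) : δ a ∈ Submodule.span K (δ '' s) := by
  induction ha using Algebra.adjoin_induction with
  | mem x hx => exact Submodule.subset_span ⟨x, hx, rfl⟩
  | algebraMap r => rw [Derivation.map_algebraMap]; exact Submodule.zero_mem _
  | add x y _ _ hx hy => rw [map_add]; exact Submodule.add_mem _ hx hy
  | mul x y _ _ hx hy =>
    rw [δ.leibniz]
    exact Submodule.add_mem _ (Submodule.smul_mem _ _ hy) (Submodule.smul_mem _ _ hx)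

/-- **`dim ≤ trdeg`** (Rosenlicht 1976, Prop. 3, spanning half, made quantitative; the step
"`Ω_{k(u,v)/k}` is a vector space of dimension `deg.tr. k(u, v)/k`" of the proof of his Thm. 1,
in the inequality form that Ax's theorem uses): for a finite set `S ⊆ K` and any `k`-derivation
`δ` of `K` into a `K`-space, the `K`-span of `δ(S)` has dimension at most `trdeg_k k[S]`.
Proof: `k[S]` has a transcendence basis `u ⊆ S` (`#u = trdeg`, Mathlib), every `s ∈ S` is
algebraic over `k[u]`, hence (`derivation_mem_of_eval_eq_zero`) `δ s ∈ span_K δ(u)`.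
[cite: Rosenlicht1976, Prop. 3] -/
theorem finrank_span_le_trdeg_adjoin [CharZero K] [IsScalarTower k K M] (δ : Derivation k K M)
    (S : Set K) (hS : S.Finite) :
    (Module.finrank K (Submodule.span K (δ '' S)) : Cardinal) ≤
      Algebra.trdeg k (Algebra.adjoin k S) := by
  classical
  set A : Subalgebra k K := Algebra.adjoin k S with hA
  set t : Set A := ((↑) : A → K) ⁻¹' S with ht
  have hinjA : Function.Injective (algebraMap k A) := (algebraMap k A).injective
  have htop : Algebra.adjoin k t = ⊤ := by
    apply Subalgebra.map_injective (f := A.val) Subtype.val_injective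
    rw [Algebra.map_top, Subalgebra.range_val, ← Algebra.adjoin_image, Subalgebra.coe_val,
      Set.image_preimage_eq_inter_range]
    have hr : Set.range ((↑) : A → K) = (A : Set K) := Subtype.range_coe
    rw [hr, Set.inter_eq_left.mpr Algebra.subset_adjoin]
  haveI : Algebra.IsAlgebraic (Algebra.adjoin k t) A := by
    rw [htop]
    exact ⟨fun a => isAlgebraic_algebraMap (⟨a, Algebra.mem_top⟩ : (⊤ : Subalgebra k A))⟩
  obtain ⟨u, -, hut, hu⟩ := exists_isTranscendenceBasis_between (R := k) ∅ t
    (Set.empty_subset _) ((algebraicIndependent_empty_iff k A).mpr hinjA)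
  have hcard : #u = Algebra.trdeg k A := hu.cardinalMk_eq_trdeg
  -- `u` is finite
  have htfin : t.Finite := hS.preimage Subtype.val_injective.injOn
  haveI : Fintype u := (htfin.subset hut).fintype
  -- the span of the differentials of `u`
  set N : Submodule K M := Submodule.span K (δ '' (((↑) : A → K) '' u)) with hN
  have hRu : ∀ a : A, a ∈ Algebra.adjoin k (Set.range ((↑) : u → A)) → δ (a : K) ∈ N := by
    intro a ha
    have ha' : (a : K) ∈ Algebra.adjoin k (((↑) : A → K) '' u) := by
      have : (a : K) ∈ (Algebra.adjoin k (Set.range ((↑) : u → A))).map A.val := ⟨a, ha, rfl⟩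
      rw [← Algebra.adjoin_image] at this
      convert this using 2
      ext x
      simp only [Set.mem_image, Set.mem_range, Subalgebra.coe_val]
      constructor
      · rintro ⟨b, hb, rfl⟩; exact ⟨b, ⟨⟨b, hb⟩, rfl⟩, rfl⟩
      · rintro ⟨b, ⟨i, rfl⟩, rfl⟩; exact ⟨i, i.2, rfl⟩
    exact derivation_apply_mem_span_of_mem_adjoin δ _ ha'
  -- every generator differentiates into `N`
  have hgen : ∀ s ∈ S, δ s ∈ N := by
    intro s hs
    have hsA : s ∈ A := Algebra.subset_adjoin hs
    have halg : IsAlgebraic (Algebra.adjoin k (Set.range ((↑) : u → A))) (⟨s, hsA⟩ : A) :=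
      hu.isAlgebraic.isAlgebraic _
    obtain ⟨p, hp0, hpx⟩ := halg
    have hφinj : Function.Injective ((algebraMap A K).comp
        (algebraMap (Algebra.adjoin k (Set.range ((↑) : u → A))) A)) :=
      fun a b h => Subtype.ext (Subtype.ext h)
    have hp' := (Polynomial.map_ne_zero_iff hφinj).mpr hp0
    have hpx' : (p.map ((algebraMap A K).comp
        (algebraMap (Algebra.adjoin k (Set.range ((↑) : u → A))) A))).eval s = 0 := by
      have hs' : algebraMap A K ⟨s, hsA⟩ = s := rfl
      have := congrArg (algebraMap A K) hpx
      rw [map_zero, aeval_def, hom_eval₂, hs'] at this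
      rwa [eval_map]
    refine derivation_mem_of_eval_eq_zero δ N hp' (fun i => ?_) hpx'
    rw [coeff_map]
    exact hRu _ (p.coeff i).2
  -- conclude
  have hle : Submodule.span K (δ '' S) ≤ N :=
    Submodule.span_le.mpr (by rintro _ ⟨s, hs, rfl⟩; exact hgen s hs)
  have hNeq : N = Submodule.span K (Set.range fun i : u => δ ((i : A) : K)) := by
    rw [hN]
    congr 1
    ext m
    simp only [Set.mem_image, Set.mem_range]
    constructor
    · rintro ⟨_, ⟨a, ha, rfl⟩, rfl⟩; exact ⟨⟨a, ha⟩, rfl⟩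
    · rintro ⟨i, rfl⟩; exact ⟨_, ⟨i, i.2, rfl⟩, rfl⟩
  haveI : Module.Finite K N := by
    rw [hNeq]; exact Module.Finite.span_of_finite K (Set.finite_range _)
  calc (Module.finrank K (Submodule.span K (δ '' S)) : Cardinal)
      ≤ (Module.finrank K N : Cardinal) := by exact_mod_cast Submodule.finrank_mono hle
    _ ≤ (Fintype.card u : Cardinal) := by
        rw [hNeq]; exact_mod_cast finrank_range_le_card _
    _ = #u := (Cardinal.mk_fintype u).symm
    _ = Algebra.trdeg k A := hcard

end Relative

end Literature.NumberTheory.Transcendental.Rosenlicht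

end
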